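import Literature.Probability.Percolation.SlabRSWSnapLayout
import Literature.Probability.Percolation.SlabRSWGluingExtB
import HarnessLib

/-!
# Newman–Tassion–Wu 2017, Lemma 3.16 — port chains through the tiles of a frame

Topic: `Literature/Probability/Percolation`. The branch of the local surgery for the coarse-grained
datum reaches a far path that arrived inside the (cleared) tiles through a lattice chain inside the
tiles (`SlabRSWSnapRoute.exists_route_port`, hypothesis `hport`). This file constructs those chains
on a frame (`SlabRSWSnapFrame/Layout.lean`), for a PORT COLUMN `x = X` (`exists_chain_col`) and a
PORT ROW `y = Y` (`exists_chain_row`): from the cell of the far path — inside some tile, hence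
(star property) inside a rectangle of tile cells containing the hub — an `L`-shaped planar path runs
to the hub's column (row) inside that rectangle and then along the port column (row), all of whose
cells are tile cells by hypothesis, to a cell next to a chosen entry cell of the free region; the
entry row (column) is chosen among four to avoid two prescribed cells.

## Sources

* C. M. Newman, V. Tassion, W. Wu, *Critical percolation and the minimal spanning tree in slabs*,
  Comm. Pure Appl. Math. 70 (2017), arXiv:1512.09107: §3.2, proof of Theorem 3.7, step (3) (the path
  `γ_w`); §3.5, proof of Lemma 3.16 ("`K_□` … regular enough") [NewmanTassionWu2017].
-/

noncomputable section

namespace Literature.Probability.Percolation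

open MeasureTheory LatticeModels SimpleGraph

namespace NTW17

variable {k : ℕ}

section Chains

variable {n : ℕ} {p : ℤ × ℤ} {x₁ x₂ y₁ y₂ X Y : ℤ} {C : Set (ℤ × ℤ)} {K : Set (ℤ × ℤ)}

/-- **Port chain along the column `x = X`.** Frame of `p`, admissible tile family `C` with union
`U'`, a region `K` free of `U'` whose cells `(X + s, y)`, `c ≤ y ≤ d` (four rows at least) are entry
cells, and the column `x = X` in `U' ∩ B` between the hub's row and the entry rows. Then every cell
`t ∈ U' ∩ B` is reached from a neighbour of an entry cell avoiding two prescribed cells by a planar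
self-avoiding path inside `(U' ∩ B) ∖ K`.
[cite: NewmanTassionWu2017, §3.2 (proof of Theorem 3.7, step (3)); §3.5 (proof of Lemma 3.16)] -/
theorem exists_chain_col (hF : IsFrame n p x₁ x₂ y₁ y₂ X Y) (hC : ∀ c ∈ C, LatCentre n c)
    (hKU : ∀ z ∈ K, z ∉ tileUnion C) (hXr : x₁ ≤ X) {s : ℤ} (hs : s = 1 ∨ s = -1) {c d : ℤ}
    (hcd : c + 3 ≤ d)
    (hent : ∀ y : ℤ, c ≤ y → y ≤ d → (X + s, y) ∈ K)
    (hcol : ∀ y : ℤ, min c (max y₁ Y) ≤ y → y ≤ max d (max y₁ Y) →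
      (X, y) ∈ tileUnion C ∧ (X, y) ∈ boxR x₁ x₂ y₁ y₂)
    {t : ℤ × ℤ} (ht : t ∈ tileUnion C) (htB : t ∈ boxR x₁ x₂ y₁ y₂) (f₁ f₂ : ℤ × ℤ) :
    ∃ e m : ℤ × ℤ, e ∈ K ∧ e ≠ f₁ ∧ e ≠ f₂ ∧ planarAdj e m ∧ ∃ l : List (ℤ × ℤ), PPath l m t ∧
      ∀ z ∈ l, (z ∈ tileUnion C ∧ z ∈ boxR x₁ x₂ y₁ y₂) ∧ z ∉ K := by
  obtain ⟨ya, hya1, hya2, hyf₁, hyf₂, -⟩ := exists_row_avoid hcd f₁.2 f₂.2 f₂.2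
  obtain ⟨a, b, c', d', htR, hhub, hR⟩ :=
    exists_rect_of_mem_tileUnion hF (fun c hc => ⟨(hC c hc).1, (hC c hc).2.1⟩) ht htB
  rw [hub, mem_boxR_iff] at hhub
  rw [mem_boxR_iff] at htR
  simp only at hhub
  have hXm : max x₁ X = X := max_eq_right hXr
  rw [hXm] at hhub
  obtain ⟨l, hl, hmem⟩ := exists_lpath_vh (X, ya) t
  refine ⟨(X + s, ya), (X, ya), hent ya hya1 hya2, fun h => hyf₁ (congrArg Prod.snd h),
    fun h => hyf₂ (congrArg Prod.snd h), ?_, l, hl, fun z hz => ?_⟩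
  · simp only [planarAdj, Prod.mk_add_mk, Prod.mk.injEq]
    omega
  · have hz' := (hmem z).1 hz
    dsimp only at hz'
    have hzU : z ∈ tileUnion C ∧ z ∈ boxR x₁ x₂ y₁ y₂ := by
      rcases hz' with ⟨hz1, hz2, hz3⟩ | ⟨hz1, hz2, hz3⟩
      · -- on the column `x = X`, between `ya` and `t.2`
        by_cases hyR : c' ≤ z.2 ∧ z.2 ≤ d'
        · exact hR (by rw [mem_boxR_iff]; omega)
        · -- outside the rectangle's rows: then between `ya` and the hub's row
          have hzeq : z = (X, z.2) := Prod.ext hz1 rfl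
          rw [hzeq]
          exact hcol z.2 (by omega) (by omega)
      · -- on the row `y = t.2`, between `X` and `t.1`: inside the rectangle
        exact hR (by rw [mem_boxR_iff]; omega)
    exact ⟨hzU, fun hzK => hKU z hzK hzU.1⟩

/-- **Port chain along the row `y = Y`** (symmetric to `exists_chain_col`): entry cells
`(x, Y + s)`, `c ≤ x ≤ d`, of `K`; the row `y = Y` in `U' ∩ B` between the hub's column and the entry
columns. [cite: NewmanTassionWu2017, §3.2 (proof of Theorem 3.7, step (3)); §3.5 (proof of Lemma 3.16)] -/
theorem exists_chain_row (hF : IsFrame n p x₁ x₂ y₁ y₂ X Y) (hC : ∀ c ∈ C, LatCentre n c)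
    (hKU : ∀ z ∈ K, z ∉ tileUnion C) (hYr : y₁ ≤ Y) {s : ℤ} (hs : s = 1 ∨ s = -1) {c d : ℤ}
    (hcd : c + 3 ≤ d)
    (hent : ∀ x : ℤ, c ≤ x → x ≤ d → (x, Y + s) ∈ K)
    (hrow : ∀ x : ℤ, min c (max x₁ X) ≤ x → x ≤ max d (max x₁ X) →
      (x, Y) ∈ tileUnion C ∧ (x, Y) ∈ boxR x₁ x₂ y₁ y₂)
    {t : ℤ × ℤ} (ht : t ∈ tileUnion C) (htB : t ∈ boxR x₁ x₂ y₁ y₂) (f₁ f₂ : ℤ × ℤ) :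
    ∃ e m : ℤ × ℤ, e ∈ K ∧ e ≠ f₁ ∧ e ≠ f₂ ∧ planarAdj e m ∧ ∃ l : List (ℤ × ℤ), PPath l m t ∧
      ∀ z ∈ l, (z ∈ tileUnion C ∧ z ∈ boxR x₁ x₂ y₁ y₂) ∧ z ∉ K := by
  obtain ⟨xa, hxa1, hxa2, hxf₁, hxf₂, -⟩ := exists_row_avoid hcd f₁.1 f₂.1 f₂.1
  obtain ⟨a, b, c', d', htR, hhub, hR⟩ :=
    exists_rect_of_mem_tileUnion hF (fun c hc => ⟨(hC c hc).1, (hC c hc).2.1⟩) ht htB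
  rw [hub, mem_boxR_iff] at hhub
  rw [mem_boxR_iff] at htR
  simp only at hhub
  have hYm : max y₁ Y = Y := max_eq_right hYr
  rw [hYm] at hhub
  obtain ⟨l, hl, hmem⟩ := exists_lpath_hv (xa, Y) t
  refine ⟨(xa, Y + s), (xa, Y), hent xa hxa1 hxa2, fun h => hxf₁ (congrArg Prod.fst h),
    fun h => hxf₂ (congrArg Prod.fst h), ?_, l, hl, fun z hz => ?_⟩
  · simp only [planarAdj, Prod.mk_add_mk, Prod.mk.injEq]
    omega
  · have hz' := (hmem z).1 hz
    dsimp only at hz'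
    have hzU : z ∈ tileUnion C ∧ z ∈ boxR x₁ x₂ y₁ y₂ := by
      rcases hz' with ⟨hz1, hz2, hz3⟩ | ⟨hz1, hz2, hz3⟩
      · -- on the row `y = Y`, between `xa` and `t.1`
        by_cases hxR : a ≤ z.1 ∧ z.1 ≤ b
        · exact hR (by rw [mem_boxR_iff]; omega)
        · have hzeq : z = (z.1, Y) := Prod.ext rfl hz1
          rw [hzeq]
          exact hrow z.1 (by omega) (by omega)
      · -- on the column `x = t.1`, between `Y` and `t.2`: inside the rectangle
        exact hR (by rw [mem_boxR_iff]; omega)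
    exact ⟨hzU, fun hzK => hKU z hzK hzU.1⟩

end Chains

end NTW17

end Literature.Probability.Percolation
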